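import Summits.ValiantsHypothesis.ValiantsHypothesis.Theses.NewtonUnitEquations

/-!
# val-idea-35 g8 — card 2 «table-rank ladder» sketch (crux stmt-ValiantsHypothesis-5906 `TwoProducts`, wave-4 R330)

Statements only (`def … : Prop`) plus ONE kernel link (`twoProducts_of_top`: the ladder exhausts at rung `m+m`).
Nothing here closes 5906 / `PlanarCellBound`; VP ≠ VNP is NOT proved.

LEVER.  The affine TABLE RANK of an instance `(f, g)`: all `2m` factors lie in the affine-linear span of
`k` polynomials `w₁ … w_k` with `≤ t` monomials.  Then `∏ f − ∏ g = P(w₁,…,w_k)` for a polynomial `P`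
(difference of two products of `m` affine forms, `deg P ≤ m`), and cancellation = "the sparse map
`Φ = (w₁,…,w_k)` osculates the hypersurface `P = 0`".  `RankLadder κ` is `TwoProducts` restricted to
table rank `≤ κ m`; `κ ≡ 1` is proved on paper (factor `P` over `ℂ`), `κ ≡ 2` splits into
`GenericRankTwoLaw` (proved on paper: initial forms on an arc with independent leads cannot cancel) and
`ParallelArcLaw` (OPEN, K1: Newton–Puiseux tower / approximate roots of the followed branch), `κ ≡ 3`
is the onset of the digit-carry (γ) regime (three leads in `ℤ²` are always dependent).
-/

noncomputable section
set_option linter.dupNamespace false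

namespace Summit.ValiantsHypothesis.ValiantsHypothesis.Cruxes.TwoProducts.ValIdea35g8b

open scoped BigOperators
open MvPolynomial
open Summit.ValiantsHypothesis.ValiantsHypothesis.Theses.NewtonUnitEquations (TwoProducts)

abbrev Poly2 := MvPolynomial (Fin 2) ℂ

/-- Planar embedding of an exponent (the one inlined in `TwoProducts`). -/
def emb : (Fin 2 →₀ ℕ) → (Fin 2 → ℝ) := fun e i => ((e i : ℕ) : ℝ)

/-- Number of vertices of the Newton polygon of `D` (the count inlined in `TwoProducts`). -/
def nv (D : Poly2) : ℕ :=
  (Set.extremePoints ℝ (convexHull ℝ (emb '' (D.support : Set (Fin 2 →₀ ℕ))))).ncard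

/-- `AffRankLe t k f g`: every factor `f j`, `g j` lies in the affine-linear span of `k` polynomials with
at most `t` monomials (WLOG chosen among the factors themselves). -/
def AffRankLe (t k : ℕ) {m : ℕ} (f g : Fin m → Poly2) : Prop :=
  ∃ w : Fin k → Poly2, (∀ i, (w i).support.card ≤ t) ∧
    (∀ j, f j ∈ Submodule.span ℂ (insert (1 : Poly2) (Set.range w))) ∧
    (∀ j, g j ∈ Submodule.span ℂ (insert (1 : Poly2) (Set.range w)))

/-- RUNG `κ` OF THE TABLE-RANK LADDER: `TwoProducts` (currency `2^{am}(t+2)^b`) restricted to instances of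
affine table rank `≤ κ m`.  `κ ≡ 1`: paper-proved (`nv ≤ 3(t+1)`).  `κ ≡ 2`: = `GenericRankTwoLaw` (proved)
+ `ParallelArcLaw` (K1, open).  `κ ≡ 3`: γ-onset.  `κ = fun m => m + m`: the crux itself
(`twoProducts_of_top`). -/
def RankLadder (κ : ℕ → ℕ) : Prop :=
  ∃ a b : ℕ, ∀ (m t : ℕ) (f g : Fin m → Poly2),
    (∀ j, (f j).support.card ≤ t) → (∀ j, (g j).support.card ≤ t) → AffRankLe t (κ m) f g →
    nv (∏ j, f j - ∏ j, g j) ≤ 2 ^ (a * m) * (t + 2) ^ b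

/-- Rung one (decided on paper: `P(w)` factors into linear factors `w - λ`, Newton polygons add). -/
def RungOne : Prop := RankLadder (fun _ => 1)

/-- Rung two (the card's toy ON (γ1): all `2m` tails are combinations of two digit-grid polynomials; contains
idea-37 g5's `toyU`, which has `m = 2`, `v = 0`, hence rank `≤ 2`). -/
def RungTwo : Prop := RankLadder (fun _ => 2)

/-- Rung three = the onset of the (γ) regime in miniature. -/
def RungThree : Prop := RankLadder (fun _ => 3)

/-- No exponent of `w₁` is parallel to an exponent of `w₂` (in particular neither has a constant term):
the "generic arcs only" hypothesis. -/
def PairwiseIndependentSupports (w₁ w₂ : Poly2) : Prop :=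
  ∀ e₁ ∈ w₁.support, ∀ e₂ ∈ w₂.support, LinearIndependent ℝ ![emb e₁, emb e₂]

/-- GENERIC RANK-TWO LAW (paper-proved this session, NOTES §γ-attempt 2): on each of the `≤ 2t` open arcs of
directions cut out by the edge normals of `Newt w₁`, `Newt w₂`, the initial form of `P(w₁,w₂)` is
`Σ_{face} P_{ik} c₁^i c₂^k X^{i e₁ + k e₂}` with `(i,k) ↦ i e₁ + k e₂` injective, so it is a non-monomial
exactly at the `≤ 4m` preimages of edge normals of `Newt P`; total `≤ 2t + 8mt`.  Stated with slack. -/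
def GenericRankTwoLaw : Prop :=
  ∀ (m t : ℕ) (P : Poly2) (w₁ w₂ : Poly2),
    P.totalDegree ≤ m → w₁.support.card ≤ t → w₂.support.card ≤ t →
    PairwiseIndependentSupports w₁ w₂ →
    nv (MvPolynomial.aeval ![w₁, w₂] P) ≤ 10 * (m + 1) * (t + 1)

/-- RANK-TWO COMPOSITION LAW (the conjectured sharp, alphabet-free form of Rung 2): the Newton polygon of
`P(w₁,w₂)` has `poly(m,t)` vertices for EVERY `P` of degree `≤ m` and all `t`-sparse `w₁, w₂`.
`t`-dependence is forced (toyU: `≥ √(t+1) − 1` with `m = 2`).  Its open content is `ParallelArcLaw`. -/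
def RankTwoCompositionLaw : Prop :=
  ∃ c : ℕ, ∀ (m t : ℕ) (P : Poly2) (w₁ w₂ : Poly2),
    P.totalDegree ≤ m → w₁.support.card ≤ t → w₂.support.card ≤ t →
    nv (MvPolynomial.aeval ![w₁, w₂] P) ≤ (m + 2) ^ c * (t + 2) ^ c

/-- The binomial defect of a parallel pair of leads `lead w₁ = c₁ M^p`, `lead w₂ = c₂ M^q` (reduced ratio,
`p, q ≤ m`): `Δ₀ = c₁^q · w₂^p − c₂^p · w₁^q`, a POLYNOMIAL with `≤ t^p + t^q` terms — the first approximate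
root of the branch of `{P = 0}` followed by `Φ = (w₁,w₂)`; on the arc, `in_ν((1+b)^p (1+a)^{-q} − 1)` is read
off `in_ν(Δ₀)`.  The parallel-arc analysis (K1, OPEN) iterates: `Δ₁ = α Δ₀^{p₁} − w₁^{n₁}, …`. -/
def binomialDefect (p q : ℕ) (c₁ c₂ : ℂ) (w₁ w₂ : Poly2) : Poly2 :=
  C (c₁ ^ q) * w₂ ^ p - C (c₂ ^ p) * w₁ ^ q

/-- K1 (OPEN) in ladder currency: generic arcs are settled by `GenericRankTwoLaw`; what remains of Rung 2 is
the parallel-arc count.  `RungTwo` is the honest typed target; `RankTwoCompositionLaw` its conjectured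
sharp form.  Kernel bookkeeping: the sharp form gives the rung (proof deferred — needs unpacking `AffRankLe`
into `P(w₁,w₂)`; recorded as a statement). -/
def compositionLaw_gives_rungTwo : Prop := RankTwoCompositionLaw → RungTwo

/-- The ladder exhausts: rank `≤ m + m` is automatic (take `w = (f, g)`), so the top rung IS the crux.
Kernel-checked. -/
theorem twoProducts_of_top (h : RankLadder (fun m => m + m)) : TwoProducts := by
  obtain ⟨a, b, H⟩ := h
  refine ⟨a, b, fun m t f g hf hg => ?_⟩
  have hw : AffRankLe t (m + m) f g := by
    refine ⟨Fin.append f g, ?_, ?_, ?_⟩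
    · intro i
      refine Fin.addCases (fun j => ?_) (fun j => ?_) i
      · rw [Fin.append_left]; exact hf j
      · rw [Fin.append_right]; exact hg j
    · intro j
      exact Submodule.subset_span (Set.mem_insert_of_mem _ ⟨Fin.castAdd m j, Fin.append_left f g j⟩)
    · intro j
      exact Submodule.subset_span (Set.mem_insert_of_mem _ ⟨Fin.natAdd m j, Fin.append_right f g j⟩)
  exact H m t f g hf hg hw

/-- Monotonicity of the ladder in the rank budget (kernel-checked bookkeeping). -/
theorem rankLadder_mono {κ κ' : ℕ → ℕ} (hle : ∀ m, κ m ≤ κ' m) (h : RankLadder κ') : RankLadder κ := by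
  obtain ⟨a, b, H⟩ := h
  refine ⟨a, b, fun m t f g hf hg hw => H m t f g hf hg ?_⟩
  obtain ⟨w, hw, hf', hg'⟩ := hw
  refine ⟨fun i => if h : (i : ℕ) < κ m then w ⟨i, h⟩ else 0, ?_, ?_, ?_⟩
  · intro i
    by_cases h : (i : ℕ) < κ m
    · simpa [h] using hw ⟨i, h⟩
    · simp [h]
  · intro j
    refine Submodule.span_mono ?_ (hf' j)
    refine Set.insert_subset_insert ?_
    rintro _ ⟨i, rfl⟩
    exact ⟨Fin.castLE (hle m) i, by simp⟩
  · intro j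
    refine Submodule.span_mono ?_ (hg' j)
    refine Set.insert_subset_insert ?_
    rintro _ ⟨i, rfl⟩
    exact ⟨Fin.castLE (hle m) i, by simp⟩

end Summit.ValiantsHypothesis.ValiantsHypothesis.Cruxes.TwoProducts.ValIdea35g8b
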